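import Summits.PneNP.PneNP.Theorems.ConvexRankGatesLinAlgGateBlindUnionDoor
import Summits.PneNP.PneNP.Theorems.ConvexRankGatesLinAlgGateBlindFacetLogWidth

/-!
# Route ConvexRankGates, crux `LinAlgGateBlind` (stmt-PneNP-10681): the union door with general GRANK at the full exponent

Support theorem for the crux. `…UnionDoor` combined every unconditionally blind wide-gate class of the crux chain at
the logarithmic width, with general `GRANK_s` only in the live-span range `s² ≤ β(m)` (`β(m) = m^{7/8}/(log₂ m)^5`),
i.e. parameter `⌊m^{γ/2}⌋`. With the facet-count door `sgAt_gRank_logWidth_facet` (`…FacetLogWidth`, through the facet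
count for linear pencils `card_facets_le`) the GRANK slot moves to `2s + 1 ≤ β(m)`:

* `not_computes_clique_of_isOver_union_logWidth'` — for every `c`, eventually in `m`, for all `d s D d₂ t` with
  `d log₂ d ≤ β`, `2s + 1 ≤ β`, `D ≤ β`, `d₂ log₂ d₂ ≤ β`, `2t ≤ β`, no circuit with `≤ m^c` gates over
  `{∧₂, ∨₂} ∪ PERM_d ∪ GRANK_s ∪ GRANKspan_D ∪ TUTTE_{d₂} ∪ MI_t` computes `CLIQUE(m, ⌈m^{1/8}⌉)` (unconditional);
* `not_computes_clique_of_isOver_union_rpow'` — the same with ONE real exponent: every class at parameter `⌊m^γ⌋`, for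
  every `γ < 7/8` — the whole algebraic basis of the crux, decoupled, at the union-bound limit `1 - δ = 7/8`.

What remains uncovered is exactly the crux's coupling `d = m^c`, `c ≥ 1` (Valiant-hard on the GRANK side,
`dcPerSuperpolynomial_of_linAlgGateBlind`; beyond every union-bound cover on the PERM side). No new definitions.
[folklore]
-/

-- `Summit.PneNP.PneNP.…` duplicates `PneNP` BY DESIGN (single-problem summit).
set_option linter.dupNamespace false

noncomputable section

namespace Summit.PneNP.PneNP.Theorems

open Finset Filter Literature.Computability.Complexity Razborov
open Summit.PneNP.PneNP.Cruxes.LinAlgGateBlind.DnfInvariantWideGatesSeeSmallCliques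
open Summit.PneNP.PneNP.Cruxes.LinAlgGateBlind.DnfInvariantWideGatesSeeSmallCliques.DenseRegime

/-- **The union door with general GRANK in the facet range (unconditional).** As
`not_computes_clique_of_isOver_union_logWidth`, with the `GRANK_s` range `s² ≤ β(m)` replaced by `2s + 1 ≤ β(m)`
(`sgAt_gRank_logWidth_facet` in place of `sgAt_gRank_logWidth`). [folklore] -/
theorem not_computes_clique_of_isOver_union_logWidth' : ∀ c : ℕ, ∀ᶠ m : ℕ in atTop, ∀ d s D d₂ t : ℕ,
    (d : ℝ) * Real.logb 2 d ≤ (m : ℝ) ^ (7 / 8 : ℝ) / Real.logb 2 m ^ 5 →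
    2 * (s : ℝ) + 1 ≤ (m : ℝ) ^ (7 / 8 : ℝ) / Real.logb 2 m ^ 5 →
    (D : ℝ) ≤ (m : ℝ) ^ (7 / 8 : ℝ) / Real.logb 2 m ^ 5 →
    (d₂ : ℝ) * Real.logb 2 d₂ ≤ (m : ℝ) ^ (7 / 8 : ℝ) / Real.logb 2 m ^ 5 →
    2 * (t : ℝ) ≤ (m : ℝ) ^ (7 / 8 : ℝ) / Real.logb 2 m ^ 5 →
    ∀ C : Circuit (KEdge m), C.IsOver ({GateFn.and 2, GateFn.or 2} ∪
      {g : GateFn | IsPermGate d g ∨ IsGRankGate s g ∨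
        (∃ (F : Type) (_ : Field F) (d' θ : ℕ) (K₀ : Matrix (Fin d') (Fin d') F) (K : Fin g.1 → Matrix (Fin d') (Fin d') F),
          Module.finrank F (Submodule.span F (Set.range K)) ≤ D ∧
            ∀ v : Fin g.1 → Bool, g.2 v = true ↔ θ ≤ (symbolicMatrix K₀ K v).rank) ∨
        (∃ d' : ℕ, d' ≤ d₂ ∧ ∃ (P₀ : Set (Fin d' × Fin d')) (P : Fin g.1 → Set (Fin d' × Fin d')),
          ∀ v : Fin g.1 → Bool, g.2 v = true ↔
            ∃ M : (SimpleGraph.fromRel fun a b : Fin d' =>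
              (a, b) ∈ {x : Fin d' × Fin d' | x ∈ P₀ ∨ ∃ i, v i = true ∧ x ∈ P i}).Subgraph, M.IsPerfectMatching) ∨
        (∃ (F : Type) (_ : DivisionRing F) (D' θ : ℕ), θ ≤ t ∧ ∃ u w : Fin g.1 → (Fin D' → F),
          ∀ v : Fin g.1 → Bool, g.2 v = true ↔ ∃ I : Finset (Fin g.1), (∀ i ∈ I, v i = true) ∧ #I = θ ∧
            Module.finrank F (Submodule.span F (u '' (I : Set (Fin g.1)))) = θ ∧
            Module.finrank F (Submodule.span F (w '' (I : Set (Fin g.1)))) = θ)}) →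
      C.size ≤ m ^ c → ¬ C.Computes (cliqueFn m ⌈(m : ℝ) ^ (1 / 8 : ℝ)⌉₊) := by
  intro c
  filter_upwards [not_computes_clique_of_collapse_level c, sgAt_perm_logWidth c, sgAt_gRank_logWidth_facet c,
    sgAt_gRankSpan_logWidth c, sgAt_tutte_logWidth c, sgAt_matroidInter_logWidth c, logWidth_le_lOf c]
    with m hhost hSGp hSGg hSGs hSGt hSGm hLl d s D d₂ t hd hs hD hd₂ ht C hC hsize
  -- the five term-gate classes, as predicates
  set Pp : GateFn → Prop := IsPermGate d with hPp
  set Pg : GateFn → Prop := IsGRankGate s with hPg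
  set Ps : GateFn → Prop := fun g => ∃ (F : Type) (_ : Field F) (d' θ : ℕ) (K₀ : Matrix (Fin d') (Fin d') F)
    (K : Fin g.1 → Matrix (Fin d') (Fin d') F), Module.finrank F (Submodule.span F (Set.range K)) ≤ D ∧
      ∀ v : Fin g.1 → Bool, g.2 v = true ↔ θ ≤ (symbolicMatrix K₀ K v).rank with hPs
  set Pt : GateFn → Prop := fun g => ∃ d' : ℕ, d' ≤ d₂ ∧ ∃ (P₀ : Set (Fin d' × Fin d'))
    (P : Fin g.1 → Set (Fin d' × Fin d')), ∀ v : Fin g.1 → Bool, g.2 v = true ↔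
      ∃ M : (SimpleGraph.fromRel fun a b : Fin d' =>
        (a, b) ∈ {x : Fin d' × Fin d' | x ∈ P₀ ∨ ∃ i, v i = true ∧ x ∈ P i}).Subgraph, M.IsPerfectMatching with hPt
  set Pm : GateFn → Prop := fun g => ∃ (F : Type) (_ : DivisionRing F) (D' θ : ℕ), θ ≤ t ∧
    ∃ u w : Fin g.1 → (Fin D' → F), ∀ v : Fin g.1 → Bool, g.2 v = true ↔ ∃ I : Finset (Fin g.1),
      (∀ i ∈ I, v i = true) ∧ #I = θ ∧ Module.finrank F (Submodule.span F (u '' (I : Set (Fin g.1)))) = θ ∧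
        Module.finrank F (Submodule.span F (w '' (I : Set (Fin g.1)))) = θ with hPm
  set Pall : GateFn → Prop := fun g => Pp g ∨ Pg g ∨ Ps g ∨ Pt g ∨ Pm g with hPall
  have hSG : SGAt m Pall ((2 * c + 8) * (Nat.log 2 m + 1)) (kOf m) (qOf m) (epsOf c m) :=
    sgAt_or (hSGp d hd) (sgAt_or (hSGg s hs) (sgAt_or (hSGs D hD) (sgAt_or (hSGt d₂ hd₂) (hSGm t ht))))
  refine hhost ((2 * c + 8) * (Nat.log 2 m + 1)) (Nat.le_mul_of_pos_right _ (Nat.succ_pos _)) hLl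
    {g | Pall g} Pall (fun g hg => ?_) (fun g hg A hA => ?_) hSG C hC hsize
  · -- monotonicity, class by class
    rcases hg with hg | hg | hg | hg | hg
    · exact IsPermGate.monotone hg
    · exact IsGRankGate.monotone hg
    · obtain ⟨F, _, d', θ, K₀, K, -, hgK⟩ := hg
      exact IsGRankGate.monotone ⟨F, inferInstance, d', θ, le_rfl, K₀, K, hgK⟩
    · obtain ⟨d', -, P₀, P, hgP⟩ := hg
      exact monotone_of_tutte g P₀ P hgP
    · obtain ⟨F, _, D', θ, -, u, w, hgu⟩ := hg
      exact monotone_of_matroidInter g u w hgu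
  · -- collapse, class by class
    rcases hg with hg | hg | hg | hg | hg
    · exact isTermGate_mono (fun _ h' => Or.inl h') ((stub_termCollapse m d _ g A hA).1 hg)
    · exact isTermGate_mono (fun _ h' => Or.inr (Or.inl h')) ((stub_termCollapse m s _ g A hA).2 hg)
    · exact isTermGate_mono (fun _ h' => Or.inr (Or.inr (Or.inl h'))) (isTermGate_gRankSpan_collapse m _ D g A hA hg)
    · exact isTermGate_mono (fun _ h' => Or.inr (Or.inr (Or.inr (Or.inl h'))))
        (isTermGate_tutte_collapse m _ d₂ g A hA hg)
    · exact isTermGate_mono (fun _ h' => Or.inr (Or.inr (Or.inr (Or.inr h'))))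
        (isTermGate_matroidInter_collapse m _ t g A hA hg)

/-- **The union door with ONE real exponent for EVERY class (unconditional).** For every `c` and every `γ < 7/8`,
eventually in `m`: no circuit with `≤ m^c` gates over
`{∧₂, ∨₂} ∪ PERM_{⌊m^γ⌋} ∪ GRANK_{⌊m^γ⌋} ∪ GRANKspan_{⌊m^γ⌋} ∪ TUTTE_{⌊m^γ⌋} ∪ MI_{⌊m^γ⌋}` computes `CLIQUE(m, ⌈m^{1/8}⌉)` —
the crux's whole algebraic basis with the gate parameter decoupled from the size exponent, every class (general GRANK
included, by the facet count) at the union-bound limit `7/8`. Supersedes `not_computes_clique_of_isOver_union_rpow`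
(general GRANK at `⌊m^{γ/2}⌋`). [folklore] -/
theorem not_computes_clique_of_isOver_union_rpow' : ∀ (c : ℕ) (γ : ℝ), γ < 7 / 8 → ∀ᶠ m : ℕ in atTop,
    ∀ C : Circuit (KEdge m), C.IsOver ({GateFn.and 2, GateFn.or 2} ∪
      {g : GateFn | IsPermGate ⌊(m : ℝ) ^ γ⌋₊ g ∨ IsGRankGate ⌊(m : ℝ) ^ γ⌋₊ g ∨
        (∃ (F : Type) (_ : Field F) (d' θ : ℕ) (K₀ : Matrix (Fin d') (Fin d') F) (K : Fin g.1 → Matrix (Fin d') (Fin d') F),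
          Module.finrank F (Submodule.span F (Set.range K)) ≤ ⌊(m : ℝ) ^ γ⌋₊ ∧
            ∀ v : Fin g.1 → Bool, g.2 v = true ↔ θ ≤ (symbolicMatrix K₀ K v).rank) ∨
        (∃ d' : ℕ, d' ≤ ⌊(m : ℝ) ^ γ⌋₊ ∧ ∃ (P₀ : Set (Fin d' × Fin d')) (P : Fin g.1 → Set (Fin d' × Fin d')),
          ∀ v : Fin g.1 → Bool, g.2 v = true ↔
            ∃ M : (SimpleGraph.fromRel fun a b : Fin d' =>
              (a, b) ∈ {x : Fin d' × Fin d' | x ∈ P₀ ∨ ∃ i, v i = true ∧ x ∈ P i}).Subgraph, M.IsPerfectMatching) ∨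
        (∃ (F : Type) (_ : DivisionRing F) (D' θ : ℕ), θ ≤ ⌊(m : ℝ) ^ γ⌋₊ ∧ ∃ u w : Fin g.1 → (Fin D' → F),
          ∀ v : Fin g.1 → Bool, g.2 v = true ↔ ∃ I : Finset (Fin g.1), (∀ i ∈ I, v i = true) ∧ #I = θ ∧
            Module.finrank F (Submodule.span F (u '' (I : Set (Fin g.1)))) = θ ∧
            Module.finrank F (Submodule.span F (w '' (I : Set (Fin g.1)))) = θ)}) →
      C.size ≤ m ^ c → ¬ C.Computes (cliqueFn m ⌈(m : ℝ) ^ (1 / 8 : ℝ)⌉₊) := by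
  intro c γ hγ
  filter_upwards [not_computes_clique_of_isOver_union_logWidth' c, eventually_floor_rpow_mul_logb_le hγ,
    eventually_two_mul_floor_rpow_add_one_le hγ, eventually_two_mul_floor_rpow_le hγ]
    with m hm hdlog hs h2 C hC hsize
  have hD : ((⌊(m : ℝ) ^ γ⌋₊ : ℕ) : ℝ) ≤ (m : ℝ) ^ (7 / 8 : ℝ) / Real.logb 2 m ^ 5 := by
    have : (0 : ℝ) ≤ ((⌊(m : ℝ) ^ γ⌋₊ : ℕ) : ℝ) := Nat.cast_nonneg _
    linarith
  exact hm _ _ _ _ _ hdlog hs hD hdlog h2 C hC hsize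

end Summit.PneNP.PneNP.Theorems

end
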